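import Summits.CriticalPhenomena.PercolationContinuityZ3.Theorems.PercNearOneGluingNoHeavyQuantLSCoreMMGIneqB
import HarnessLib

/-!
# QUANT lane R8, T-DEC, binder (II) `ConvClosedTResidue`: LS-CORE, pattern MMG — the four breakpoint inequalities of the two-low greedy,
# by case analysis over the light/heavy/absent branches of the six cross pairs (breakpoints hkG, hkC, hkB, hkA)

builds on p205010 (kernel theorem, internal audit signed; external expert review pending)

Support file (`--supports stmt-CriticalPhenomena-4575`), QUANT lane seat prim-quant-census-1 (gen 22), rung R8 of
`run/shared/lean/prim/quant/LADDER.md`.  Theorems only, standard axioms, no sorries.  Memo `…/prim-quant-census-1/LSCORE-G22.md` §2–§3.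

In the scale-free coordinates of `…QuantLSCoreMMGIneqA` (floor `x`, light rate `r`, tail gap `t`, span ratio `w ≤ 1`, `d = ρ_c w`),
with the six efficiencies `e2P, e22, e21` (low `p+l′` into `p+h, m+l′, m+l`) and `e1P, e12, e11` (low `p+l`) given by their conditional closed
forms (absent / heavy / light), the lemmas below are the hypotheses `hkG`, `hkC`, `hkB`, `hkA` of `LawDec.twoLow_greedy_flows`
(`…QuantTwoLowGreedy`) for the light-slice law: each is a case analysis ending in one cell of `…QuantLSCoreMMGIneqA/B`.

[this work].  The gluing rows served [cite: KozmaNitzan2024, Conjecture 3 (p. 15)]; product measure [cite: Grimmett1999, §1.3 p. 10].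
-/

namespace Summit.CriticalPhenomena.PercolationContinuityZ3.Theorems

namespace Quant

namespace LawDec

namespace LSCoreMMG

set_option maxHeartbeats 4000000 in
/-- **`hkG` (breakpoint at the giant pool)**: `P₁ + P₂ ≤ a₂(m+l) + a₂(m+l′) + a₂(p+h) + pool`. [this work] -/
theorem hkG_holds (x r t d w e2P e22 e21 : ℝ) (hx0 : 0 < x) (hx1 : x < 1) (hr0 : 0 ≤ r) (hrx : r < x) (ht : 0 < t) (hw0 : 0 < w) (hw1 : w ≤ 1)
    (hd0 : 0 ≤ d) (hdx : d < x * w) (hre : 0 < r - x + t * (2 - x)) (hre1 : 0 < 1 - t - r)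
    (hA2 : r + d ≤ 2) (hM1 : r + d + 2 * t ≤ 2 * w)
    (h2P_N : 1 ≤ (r + d) → e2P = 0)
    (h2P_H : x ≤ (r + d) → (r + d) < 1 → e2P = (1 / (r + d) - 1))
    (h2P_L : (r + d) < x → e2P = (1 / ((1 - x) * (r + d) + x ^ 2) - 1))
    (h22_N : w ≤ (r + d) → e22 = 0)
    (h22_H : x * w ≤ (r + d) → (r + d) < w → e22 = (w / (r + d) - 1))
    (h22_L : (r + d) < x * w → e22 = (w / ((1 - x) * (r + d) + x ^ 2 * w) - 1))
    (h21_N : w - t ≤ (r + d) → e21 = 0)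
    (h21_H : x * (w - t) ≤ (r + d) → (r + d) < w - t → e21 = ((w - t) / (r + d) - 1))
    (h21_L : (r + d) < x * (w - t) → e21 = ((w - t) / ((1 - x) * (r + d) + x ^ 2 * (w - t)) - 1)) :
    ((1 - (x ^ 2 + (1 - x) * d / w)) * (1 - x) * ((x - r) * (1 - t - r) / (t * (2 - x ^ 2 - (1 - x) * r) - x * (x - r)))) + ((1 - (x ^ 2 + (1 - x) * d / w)) * (1 - x) * ((1 + x - r) * (r - x + t * (2 - x)) / (t * (2 - x ^ 2 - (1 - x) * r) - x * (x - r)))) ≤ ((x ^ 2 + (1 - x) * d / w) * (1 - x) * ((x - r) * (1 - t - r) / (t * (2 - x ^ 2 - (1 - x) * r) - x * (x - r)))) * e21 + ((x ^ 2 + (1 - x) * d / w) * (1 - x) * ((1 + x - r) * (r - x + t * (2 - x)) / (t * (2 - x ^ 2 - (1 - x) * r) - x * (x - r)))) * e22 + ((1 - (x ^ 2 + (1 - x) * d / w)) * x) * e2P + ((x ^ 2 + (1 - x) * d / w) * (1 - x)) := by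
  have hD : 0 < t * (2 - x ^ 2 - (1 - x) * r) - x * (x - r) := D_pos x r t hx0 hx1 hr0 hrx hre
  have hxw : x * w ≤ x := by nlinarith
  have hxwt : x * (w - t) ≤ x * w := by nlinarith
  -- masses are nonnegative
  have hg0 : 0 ≤ (x ^ 2 + (1 - x) * d / w) := by positivity
  have hlam : 0 ≤ (x - r) * (1 - t - r) / (t * (2 - x ^ 2 - (1 - x) * r) - x * (x - r)) := div_nonneg (mul_nonneg (by linarith) (by linarith)) hD.le
  have hlaml : 0 ≤ (1 + x - r) * (r - x + t * (2 - x)) / (t * (2 - x ^ 2 - (1 - x) * r) - x * (x - r)) := div_nonneg (mul_nonneg (by linarith) hre.le) hD.le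
  have hcM1 : 0 ≤ ((x ^ 2 + (1 - x) * d / w) * (1 - x) * ((x - r) * (1 - t - r) / (t * (2 - x ^ 2 - (1 - x) * r) - x * (x - r)))) := mul_nonneg (mul_nonneg hg0 (by linarith)) hlam
  have hcM2 : 0 ≤ ((x ^ 2 + (1 - x) * d / w) * (1 - x) * ((1 + x - r) * (r - x + t * (2 - x)) / (t * (2 - x ^ 2 - (1 - x) * r) - x * (x - r)))) := mul_nonneg (mul_nonneg hg0 (by linarith)) hlaml
  rcases lt_or_ge ((r + d)) x with hL | hHx
  · -- light `p+l′ → p+h`: the head cell alone absorbs both lows at the giant rate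
    have he21 : 0 ≤ e21 := by
      rcases lt_or_ge ((r + d)) (x * (w - t)) with h1 | h1
      · rw [h21_L h1]
        have hG : 0 < (1 - x) * (r + d) + x ^ 2 * (w - t) := by nlinarith [mul_pos hx0 hx0]
        rw [sub_nonneg, le_div_iff₀ hG]; nlinarith [mul_pos hx0 hx0]
      · rcases lt_or_ge ((r + d)) (w - t) with h2 | h2
        · rw [h21_H h1 h2]
          have hA : 0 < (r + d) := by nlinarith [mul_pos hx0 hx0]
          rw [sub_nonneg, le_div_iff₀ hA]; linarith
        · rw [h21_N h2]
    have he22 : 0 ≤ e22 := by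
      rcases lt_or_ge ((r + d)) (x * w) with h1 | h1
      · rw [h22_L h1]
        have hG : 0 < ((1 - x) * (r + d) + x ^ 2 * w) := by positivity
        rw [sub_nonneg, le_div_iff₀ hG]; nlinarith [mul_pos hx0 hx0]
      · rcases lt_or_ge ((r + d)) w with h2 | h2
        · rw [h22_H h1 h2]
          have hA : 0 < (r + d) := by nlinarith [mul_pos hx0 hw0]
          rw [sub_nonneg, le_div_iff₀ hA]; linarith
        · rw [h22_N h2]
    rw [h2P_L hL]
    have hG : 0 < ((1 - x) * (r + d) + x ^ 2) := by positivity
    have hGx : ((1 - x) * (r + d) + x ^ 2) ≤ x := by nlinarith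
    -- `(1−γ)x·(1/G − 1) ≥ (1−γ)(1−x)` and `P₁ + P₂ = (1−γ)(1−x)`
    have hsum : ((1 - (x ^ 2 + (1 - x) * d / w)) * (1 - x) * ((x - r) * (1 - t - r) / (t * (2 - x ^ 2 - (1 - x) * r) - x * (x - r)))) + ((1 - (x ^ 2 + (1 - x) * d / w)) * (1 - x) * ((1 + x - r) * (r - x + t * (2 - x)) / (t * (2 - x ^ 2 - (1 - x) * r) - x * (x - r)))) = (1 - (x ^ 2 + (1 - x) * d / w)) * (1 - x) := by
      have : (x - r) * (1 - t - r) / (t * (2 - x ^ 2 - (1 - x) * r) - x * (x - r)) + (1 + x - r) * (r - x + t * (2 - x)) / (t * (2 - x ^ 2 - (1 - x) * r) - x * (x - r)) = 1 := by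
        rw [← add_div, div_eq_one_iff_eq hD.ne']; ring
      linear_combination (1 - (x ^ 2 + (1 - x) * d / w)) * (1 - x) * this
    have hg1 : (x ^ 2 + (1 - x) * d / w) ≤ 1 := by
      have h4 : d / w ≤ x := by rw [div_le_iff₀ hw0]; linarith
      have h5 : (1 - x) * d / w ≤ (1 - x) * x := by
        rw [mul_div_assoc]; exact mul_le_mul_of_nonneg_left h4 (by linarith)
      nlinarith
    have hhead : (1 - (x ^ 2 + (1 - x) * d / w)) * (1 - x) ≤ (1 - (x ^ 2 + (1 - x) * d / w)) * x * (1 / ((1 - x) * (r + d) + x ^ 2) - 1) := by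
      have h1 : (1 - x) ≤ x * (1 / ((1 - x) * (r + d) + x ^ 2) - 1) := by
        rw [show x * (1 / ((1 - x) * (r + d) + x ^ 2) - 1) = x / ((1 - x) * (r + d) + x ^ 2) - x by ring, le_sub_iff_add_le, le_div_iff₀ hG]
        nlinarith
      have := mul_le_mul_of_nonneg_left h1 (by linarith : 0 ≤ 1 - (x ^ 2 + (1 - x) * d / w))
      linarith [this]
    nlinarith [mul_nonneg hcM1 he21, mul_nonneg hcM2 he22, mul_nonneg hg0 (by linarith : (0:ℝ) ≤ 1 - x)]
  · rcases lt_or_ge ((r + d)) 1 with hH1 | hN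
    · -- heavy `p+l′ → p+h`
      rw [h2P_H hHx hH1]
      rcases lt_or_ge ((r + d)) w with hw2 | hw2
      · rw [h22_H (le_trans hxw hHx) hw2]
        rcases lt_or_ge ((r + d)) (w - t) with hw3 | hw3
        · rw [h21_H (le_trans hxwt (le_trans hxw hHx)) hw3]
          have := ineq_BMH_HHH x r t d w hx0 hx1 hr0 hrx ht hw0 hw1 hd0 hdx hre hre1 hA2 hM1 hHx hH1 (le_trans hxw hHx) hw2 (le_trans hxwt (le_trans hxw hHx)) hw3
          linarith
        · rw [h21_N hw3]
          have := ineq_BMH_HHN x r t d w hx0 hx1 hr0 hrx ht hw0 hw1 hd0 hdx hre hre1 hA2 hM1 hHx hH1 (le_trans hxw hHx) hw2 hw3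
          linarith
      · have hw3 : w - t ≤ (r + d) := by linarith
        rw [h22_N hw2, h21_N hw3]
        have := ineq_BMH_HNN x r t d w hx0 hx1 hr0 hrx ht hw0 hw1 hd0 hdx hre hre1 hA2 hM1 hHx hH1 hw2 hw3
        linarith
    · -- no mid for the low `p+l′`: `γ ≥ 1/2`
      rw [h2P_N hN, h22_N (le_trans hw1 hN), h21_N (by linarith)]
      have hsum : ((1 - (x ^ 2 + (1 - x) * d / w)) * (1 - x) * ((x - r) * (1 - t - r) / (t * (2 - x ^ 2 - (1 - x) * r) - x * (x - r)))) + ((1 - (x ^ 2 + (1 - x) * d / w)) * (1 - x) * ((1 + x - r) * (r - x + t * (2 - x)) / (t * (2 - x ^ 2 - (1 - x) * r) - x * (x - r)))) = (1 - (x ^ 2 + (1 - x) * d / w)) * (1 - x) := by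
        have : (x - r) * (1 - t - r) / (t * (2 - x ^ 2 - (1 - x) * r) - x * (x - r)) + (1 + x - r) * (r - x + t * (2 - x)) / (t * (2 - x ^ 2 - (1 - x) * r) - x * (x - r)) = 1 := by
          rw [← add_div, div_eq_one_iff_eq hD.ne']; ring
        linear_combination (1 - (x ^ 2 + (1 - x) * d / w)) * (1 - x) * this
      have hdw : 1 - x ≤ d / w := by rw [le_div_iff₀ hw0]; nlinarith
      have h5 : (1 - x) * (1 - x) ≤ (1 - x) * d / w := by
        rw [mul_div_assoc]; exact mul_le_mul_of_nonneg_left hdw (by linarith)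
      have hg2 : 1 ≤ 2 * (x ^ 2 + (1 - x) * d / w) := by nlinarith [sq_nonneg (2 * x - 1)]
      nlinarith [mul_nonneg hcM1 (le_refl 0), hg2]

set_option maxHeartbeats 4000000 in
/-- **`hkC` (low 2 stops at the head cell `p+h`)**: `P₁ ≤ (a₂(m+l) + a₂(m+l′) + a₂(p+h) − P₂)·κ_C + pool`. [this work] -/
theorem hkC_holds (x r t d w e2P e22 e21 κC : ℝ) (hx0 : 0 < x) (hx1 : x < 1) (hr0 : 0 ≤ r) (hrx : r < x) (ht : 0 < t) (hw0 : 0 < w) (hw1 : w ≤ 1)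
    (hd0 : 0 ≤ d) (hdx : d < x * w) (hre : 0 < r - x + t * (2 - x)) (hre1 : 0 < 1 - t - r)
    (hA2 : r + d ≤ 2) (hM1 : r + d + 2 * t ≤ 2 * w)
    (_h2P_N : 1 ≤ (r + d) → e2P = 0)
    (h2P_H : x ≤ (r + d) → (r + d) < 1 → e2P = (1 / (r + d) - 1))
    (h2P_L : (r + d) < x → e2P = (1 / ((1 - x) * (r + d) + x ^ 2) - 1))
    (h22_N : w ≤ (r + d) → e22 = 0)
    (h22_H : x * w ≤ (r + d) → (r + d) < w → e22 = (w / (r + d) - 1))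
    (h22_L : (r + d) < x * w → e22 = (w / ((1 - x) * (r + d) + x ^ 2 * w) - 1))
    (h21_N : w - t ≤ (r + d) → e21 = 0)
    (h21_H : x * (w - t) ≤ (r + d) → (r + d) < w - t → e21 = ((w - t) / (r + d) - 1))
    (h21_L : (r + d) < x * (w - t) → e21 = ((w - t) / ((1 - x) * (r + d) + x ^ 2 * (w - t)) - 1))
    (hκ_N : 1 + t ≤ (r + d + 2 * t) → κC = 0) (hκ_H : (r + d + 2 * t) < 1 + t → x ≤ (r + d) → (r + d) < 1 → κC = (((1 + t) - (r + d + 2 * t)) * (r + d) / ((r + d + 2 * t) * (1 - (r + d))))) (hκ_L : (r + d + 2 * t) < 1 + t → (r + d) < x → κC = (((1 + t) - (r + d + 2 * t)) * ((1 - x) * (r + d) + x ^ 2) / ((r + d + 2 * t) * (1 - ((1 - x) * (r + d) + x ^ 2)))))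
    (hav : (r + d) < 1) :
    ((1 - (x ^ 2 + (1 - x) * d / w)) * (1 - x) * ((x - r) * (1 - t - r) / (t * (2 - x ^ 2 - (1 - x) * r) - x * (x - r)))) ≤ (((x ^ 2 + (1 - x) * d / w) * (1 - x) * ((x - r) * (1 - t - r) / (t * (2 - x ^ 2 - (1 - x) * r) - x * (x - r)))) * e21 + ((x ^ 2 + (1 - x) * d / w) * (1 - x) * ((1 + x - r) * (r - x + t * (2 - x)) / (t * (2 - x ^ 2 - (1 - x) * r) - x * (x - r)))) * e22 + ((1 - (x ^ 2 + (1 - x) * d / w)) * x) * e2P - ((1 - (x ^ 2 + (1 - x) * d / w)) * (1 - x) * ((1 + x - r) * (r - x + t * (2 - x)) / (t * (2 - x ^ 2 - (1 - x) * r) - x * (x - r))))) * κC + ((x ^ 2 + (1 - x) * d / w) * (1 - x)) := by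
  have hD : 0 < t * (2 - x ^ 2 - (1 - x) * r) - x * (x - r) := D_pos x r t hx0 hx1 hr0 hrx hre
  have hxw : x * w ≤ x := by nlinarith
  have hxwt : x * (w - t) ≤ x * w := by nlinarith
  have hg0 : 0 ≤ (x ^ 2 + (1 - x) * d / w) := by positivity
  have hlam : 0 ≤ (x - r) * (1 - t - r) / (t * (2 - x ^ 2 - (1 - x) * r) - x * (x - r)) := div_nonneg (mul_nonneg (by linarith) (by linarith)) hD.le
  have hlaml : 0 ≤ (1 + x - r) * (r - x + t * (2 - x)) / (t * (2 - x ^ 2 - (1 - x) * r) - x * (x - r)) := div_nonneg (mul_nonneg (by linarith) hre.le) hD.le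
  have hcM1 : 0 ≤ ((x ^ 2 + (1 - x) * d / w) * (1 - x) * ((x - r) * (1 - t - r) / (t * (2 - x ^ 2 - (1 - x) * r) - x * (x - r)))) := mul_nonneg (mul_nonneg hg0 (by linarith)) hlam
  have hcM2 : 0 ≤ ((x ^ 2 + (1 - x) * d / w) * (1 - x) * ((1 + x - r) * (r - x + t * (2 - x)) / (t * (2 - x ^ 2 - (1 - x) * r) - x * (x - r)))) := mul_nonneg (mul_nonneg hg0 (by linarith)) hlaml
  rcases lt_or_ge ((r + d + 2 * t)) (1 + t) with hP | hPn
  · rcases lt_or_ge ((r + d)) x with hL | hH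
    · -- light head pair: one weakened cell for every branch of the M-pairs
      have hG : 0 < ((1 - x) * (r + d) + x ^ 2) := by positivity
      have hGx : ((1 - x) * (r + d) + x ^ 2) < 1 := by nlinarith
      have hB : 0 < (r + d + 2 * t) := by linarith
      rw [h2P_L hL, hκ_L hP hL]
      have hκ0 : 0 ≤ ((1 + t) - (r + d + 2 * t)) * ((1 - x) * (r + d) + x ^ 2) / ((r + d + 2 * t) * (1 - ((1 - x) * (r + d) + x ^ 2))) :=
        div_nonneg (mul_nonneg (by linarith) hG.le) (mul_nonneg hB.le (by linarith))
      have h22w : w / ((1 - x) * (r + d) + x ^ 2) - 1 ≤ e22 := by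
        rcases lt_or_ge ((r + d)) (x * w) with h1 | h1
        · rw [h22_L h1]
          have hG2 : 0 < ((1 - x) * (r + d) + x ^ 2 * w) := by positivity
          have : w / ((1 - x) * (r + d) + x ^ 2) ≤ w / ((1 - x) * (r + d) + x ^ 2 * w) := div_le_div_of_nonneg_left hw0.le hG2 (by nlinarith)
          linarith
        · rcases lt_or_ge ((r + d)) w with h2 | h2
          · rw [h22_H h1 h2]
            have hA : 0 < (r + d) := by nlinarith [mul_pos hx0 hw0]
            have : w / ((1 - x) * (r + d) + x ^ 2) ≤ w / (r + d) := div_le_div_of_nonneg_left hw0.le hA (by nlinarith)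
            linarith
          · rw [h22_N h2]
            rw [sub_nonpos, div_le_one hG]; nlinarith
      have h21w : (w - t) / ((1 - x) * (r + d) + x ^ 2) - 1 ≤ e21 := by
        rcases lt_or_ge ((r + d)) (x * (w - t)) with h1 | h1
        · rw [h21_L h1]
          have hwt : 0 < w - t := by nlinarith [mul_pos hx0 hw0]
          have hG2 : 0 < ((1 - x) * (r + d) + x ^ 2 * (w - t)) := by positivity
          have : (w - t) / ((1 - x) * (r + d) + x ^ 2) ≤ (w - t) / ((1 - x) * (r + d) + x ^ 2 * (w - t)) := div_le_div_of_nonneg_left hwt.le hG2 (by nlinarith)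
          linarith
        · rcases lt_or_ge ((r + d)) (w - t) with h2 | h2
          · rw [h21_H h1 h2]
            have hA : 0 < (r + d) := by nlinarith [mul_pos hx0 hw0, mul_pos hx0 ht]
            have hwt : 0 ≤ w - t := by linarith
            have : (w - t) / ((1 - x) * (r + d) + x ^ 2) ≤ (w - t) / (r + d) := div_le_div_of_nonneg_left hwt hA (by nlinarith)
            linarith
          · rw [h21_N h2]
            rw [sub_nonpos, div_le_one hG]; nlinarith
      have hcell := ineq_BPH_Lany x r t d w hx0 hx1 hr0 hrx ht hw0 hw1 hd0 hdx hre hre1 hA2 hM1 hL hP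
      have hmono : (((x ^ 2 + (1 - x) * d / w) * (1 - x) * ((x - r) * (1 - t - r) / (t * (2 - x ^ 2 - (1 - x) * r) - x * (x - r)))) * ((w - t) / ((1 - x) * (r + d) + x ^ 2) - 1) + ((x ^ 2 + (1 - x) * d / w) * (1 - x) * ((1 + x - r) * (r - x + t * (2 - x)) / (t * (2 - x ^ 2 - (1 - x) * r) - x * (x - r)))) * (w / ((1 - x) * (r + d) + x ^ 2) - 1) + ((1 - (x ^ 2 + (1 - x) * d / w)) * x) * (1 / ((1 - x) * (r + d) + x ^ 2) - 1) - ((1 - (x ^ 2 + (1 - x) * d / w)) * (1 - x) * ((1 + x - r) * (r - x + t * (2 - x)) / (t * (2 - x ^ 2 - (1 - x) * r) - x * (x - r)))))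
          * (((1 + t) - (r + d + 2 * t)) * ((1 - x) * (r + d) + x ^ 2) / ((r + d + 2 * t) * (1 - ((1 - x) * (r + d) + x ^ 2))))
          ≤ (((x ^ 2 + (1 - x) * d / w) * (1 - x) * ((x - r) * (1 - t - r) / (t * (2 - x ^ 2 - (1 - x) * r) - x * (x - r)))) * e21 + ((x ^ 2 + (1 - x) * d / w) * (1 - x) * ((1 + x - r) * (r - x + t * (2 - x)) / (t * (2 - x ^ 2 - (1 - x) * r) - x * (x - r)))) * e22 + ((1 - (x ^ 2 + (1 - x) * d / w)) * x) * (1 / ((1 - x) * (r + d) + x ^ 2) - 1) - ((1 - (x ^ 2 + (1 - x) * d / w)) * (1 - x) * ((1 + x - r) * (r - x + t * (2 - x)) / (t * (2 - x ^ 2 - (1 - x) * r) - x * (x - r))))) * (((1 + t) - (r + d + 2 * t)) * ((1 - x) * (r + d) + x ^ 2) / ((r + d + 2 * t) * (1 - ((1 - x) * (r + d) + x ^ 2)))) := by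
        apply mul_le_mul_of_nonneg_right _ hκ0
        nlinarith [mul_le_mul_of_nonneg_left h21w hcM1, mul_le_mul_of_nonneg_left h22w hcM2]
      linarith
    · -- heavy head pair
      rw [h2P_H hH hav, hκ_H hP hH hav]
      rcases lt_or_ge ((r + d)) w with hw2 | hw2
      · rw [h22_H (le_trans hxw hH) hw2]
        rcases lt_or_ge ((r + d)) (w - t) with hw3 | hw3
        · rw [h21_H (le_trans hxwt (le_trans hxw hH)) hw3]
          have := ineq_BPH_HHH x r t d w hx0 hx1 hr0 hrx ht hw0 hw1 hd0 hdx hre hre1 hA2 hM1 hH hav (le_trans hxw hH) hw2 (le_trans hxwt (le_trans hxw hH)) hw3 hP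
          linarith
        · rw [h21_N hw3]
          have := ineq_BPH_HHN x r t d w hx0 hx1 hr0 hrx ht hw0 hw1 hd0 hdx hre hre1 hA2 hM1 hH hav (le_trans hxw hH) hw2 hw3 hP
          linarith
      · have hw3 : w - t ≤ (r + d) := by linarith
        rw [h22_N hw2, h21_N hw3]
        have := ineq_BPH_HNN x r t d w hx0 hx1 hr0 hrx ht hw0 hw1 hd0 hdx hre hre1 hA2 hM1 hH hav hw2 hw3 hP
        linarith
  · -- no mid at all for the low `p+l`: the pool alone
    rw [hκ_N hPn]
    have h12n : w + t ≤ (r + d + 2 * t) := by linarith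
    have h11n : w ≤ (r + d + 2 * t) := by linarith
    have := ineq_E1_NNN x r t d w hx0 hx1 hr0 hrx ht hw0 hw1 hd0 hdx hre hre1 hA2 hM1 hPn h12n h11n
    nlinarith [this]

set_option maxHeartbeats 4000000 in
/-- **`hkB` (low 2 stops at the mid `m+l′`)**: `P₁ ≤ (a₂(m+l) + a₂(m+l′) − P₂)·κ_B + a₁(p+h) + pool`. [this work] -/
theorem hkB_holds (x r t d w e22 e21 e1P κB : ℝ) (hx0 : 0 < x) (hx1 : x < 1) (hr0 : 0 ≤ r) (hrx : r < x) (ht : 0 < t) (hw0 : 0 < w) (hw1 : w ≤ 1)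
    (hd0 : 0 ≤ d) (hdx : d < x * w) (hre : 0 < r - x + t * (2 - x)) (hre1 : 0 < 1 - t - r)
    (hA2 : r + d ≤ 2) (hM1 : r + d + 2 * t ≤ 2 * w)
    (_h22_N : w ≤ (r + d) → e22 = 0)
    (h22_H : x * w ≤ (r + d) → (r + d) < w → e22 = (w / (r + d) - 1))
    (h22_L : (r + d) < x * w → e22 = (w / ((1 - x) * (r + d) + x ^ 2 * w) - 1))
    (_h21_N : w - t ≤ (r + d) → e21 = 0)
    (h21_H : x * (w - t) ≤ (r + d) → (r + d) < w - t → e21 = ((w - t) / (r + d) - 1))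
    (h21_L : (r + d) < x * (w - t) → e21 = ((w - t) / ((1 - x) * (r + d) + x ^ 2 * (w - t)) - 1))
    (h1P_N : 1 + t ≤ (r + d + 2 * t) → e1P = 0)
    (h1P_H : (r + d + 2 * t) < 1 + t → e1P = ((1 + t) / (r + d + 2 * t) - 1))
    (hκ_N : w + t ≤ (r + d + 2 * t) → κB = 0) (hκ_H : (r + d + 2 * t) < w + t → x * w ≤ (r + d) → (r + d) < w → κB = (((w + t) - (r + d + 2 * t)) * (r + d) / ((r + d + 2 * t) * (w - (r + d))))) (hκ_L : (r + d + 2 * t) < w + t → (r + d) < x * w → κB = (((w + t) - (r + d + 2 * t)) * ((1 - x) * (r + d) + x ^ 2 * w) / ((r + d + 2 * t) * (w - ((1 - x) * (r + d) + x ^ 2 * w)))))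
    (hav : (r + d) < w) :
    ((1 - (x ^ 2 + (1 - x) * d / w)) * (1 - x) * ((x - r) * (1 - t - r) / (t * (2 - x ^ 2 - (1 - x) * r) - x * (x - r)))) ≤ (((x ^ 2 + (1 - x) * d / w) * (1 - x) * ((x - r) * (1 - t - r) / (t * (2 - x ^ 2 - (1 - x) * r) - x * (x - r)))) * e21 + ((x ^ 2 + (1 - x) * d / w) * (1 - x) * ((1 + x - r) * (r - x + t * (2 - x)) / (t * (2 - x ^ 2 - (1 - x) * r) - x * (x - r)))) * e22 - ((1 - (x ^ 2 + (1 - x) * d / w)) * (1 - x) * ((1 + x - r) * (r - x + t * (2 - x)) / (t * (2 - x ^ 2 - (1 - x) * r) - x * (x - r))))) * κB + ((1 - (x ^ 2 + (1 - x) * d / w)) * x) * e1P + ((x ^ 2 + (1 - x) * d / w) * (1 - x)) := by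
  have hD : 0 < t * (2 - x ^ 2 - (1 - x) * r) - x * (x - r) := D_pos x r t hx0 hx1 hr0 hrx hre
  have hxw : x * w ≤ x := by nlinarith
  have hxwt : x * (w - t) ≤ x * w := by nlinarith
  have hg0 : 0 ≤ (x ^ 2 + (1 - x) * d / w) := by positivity
  have hlam : 0 ≤ (x - r) * (1 - t - r) / (t * (2 - x ^ 2 - (1 - x) * r) - x * (x - r)) := div_nonneg (mul_nonneg (by linarith) (by linarith)) hD.le
  have hlaml : 0 ≤ (1 + x - r) * (r - x + t * (2 - x)) / (t * (2 - x ^ 2 - (1 - x) * r) - x * (x - r)) := div_nonneg (mul_nonneg (by linarith) hre.le) hD.le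
  have hcM1 : 0 ≤ ((x ^ 2 + (1 - x) * d / w) * (1 - x) * ((x - r) * (1 - t - r) / (t * (2 - x ^ 2 - (1 - x) * r) - x * (x - r)))) := mul_nonneg (mul_nonneg hg0 (by linarith)) hlam
  have hcM2 : 0 ≤ ((x ^ 2 + (1 - x) * d / w) * (1 - x) * ((1 + x - r) * (r - x + t * (2 - x)) / (t * (2 - x ^ 2 - (1 - x) * r) - x * (x - r)))) := mul_nonneg (mul_nonneg hg0 (by linarith)) hlaml
  rcases lt_or_ge ((r + d + 2 * t)) (w + t) with hm | hmn
  · -- the low `p+l` may use `m+l′`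
    have hP : (r + d + 2 * t) < 1 + t := by linarith
    have h21b : (r + d) < w - t := by linarith
    rw [h1P_H hP]
    rcases lt_or_ge ((r + d)) (x * w) with hL | hH
    · -- light `p+l′ → m+l′`
      have hG2 : 0 < ((1 - x) * (r + d) + x ^ 2 * w) := by positivity
      have hGw : ((1 - x) * (r + d) + x ^ 2 * w) < w := by nlinarith [mul_pos hx0 hw0]
      have hB : 0 < (r + d + 2 * t) := by linarith
      rw [h22_L hL, hκ_L hm hL]
      have hκ0 : 0 ≤ ((w + t) - (r + d + 2 * t)) * ((1 - x) * (r + d) + x ^ 2 * w) / ((r + d + 2 * t) * (w - ((1 - x) * (r + d) + x ^ 2 * w))) :=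
        div_nonneg (mul_nonneg (by linarith) hG2.le) (mul_nonneg hB.le (by linarith))
      have h21w : (w - t) / ((1 - x) * (r + d) + x ^ 2 * w) - 1 ≤ e21 := by
        rcases lt_or_ge ((r + d)) (x * (w - t)) with h1 | h1
        · rw [h21_L h1]
          have hwt : 0 < w - t := by nlinarith [mul_pos hx0 hw0]
          have hG3 : 0 < ((1 - x) * (r + d) + x ^ 2 * (w - t)) := by positivity
          have : (w - t) / ((1 - x) * (r + d) + x ^ 2 * w) ≤ (w - t) / ((1 - x) * (r + d) + x ^ 2 * (w - t)) := div_le_div_of_nonneg_left hwt.le hG3 (by nlinarith)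
          linarith
        · rw [h21_H h1 h21b]
          have hA : 0 < (r + d) := by nlinarith [mul_pos hx0 hw0, mul_pos hx0 ht]
          have hwt : 0 ≤ w - t := by linarith
          have : (w - t) / ((1 - x) * (r + d) + x ^ 2 * w) ≤ (w - t) / (r + d) := div_le_div_of_nonneg_left hwt hA (by nlinarith)
          linarith
      have hcell := ineq_BM2_L x r t d w hx0 hx1 hr0 hrx ht hw0 hw1 hd0 hdx hre hre1 hA2 hM1 hL hP hm
      have hmono : (((x ^ 2 + (1 - x) * d / w) * (1 - x) * ((x - r) * (1 - t - r) / (t * (2 - x ^ 2 - (1 - x) * r) - x * (x - r)))) * ((w - t) / ((1 - x) * (r + d) + x ^ 2 * w) - 1) + ((x ^ 2 + (1 - x) * d / w) * (1 - x) * ((1 + x - r) * (r - x + t * (2 - x)) / (t * (2 - x ^ 2 - (1 - x) * r) - x * (x - r)))) * (w / ((1 - x) * (r + d) + x ^ 2 * w) - 1) - ((1 - (x ^ 2 + (1 - x) * d / w)) * (1 - x) * ((1 + x - r) * (r - x + t * (2 - x)) / (t * (2 - x ^ 2 - (1 - x) * r) - x * (x - r))))) * (((w + t) - (r + d + 2 *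 t)) * ((1 - x) * (r + d) + x ^ 2 * w) / ((r + d + 2 * t) * (w - ((1 - x) * (r + d) + x ^ 2 * w))))
          ≤ (((x ^ 2 + (1 - x) * d / w) * (1 - x) * ((x - r) * (1 - t - r) / (t * (2 - x ^ 2 - (1 - x) * r) - x * (x - r)))) * e21 + ((x ^ 2 + (1 - x) * d / w) * (1 - x) * ((1 + x - r) * (r - x + t * (2 - x)) / (t * (2 - x ^ 2 - (1 - x) * r) - x * (x - r)))) * (w / ((1 - x) * (r + d) + x ^ 2 * w) - 1) - ((1 - (x ^ 2 + (1 - x) * d / w)) * (1 - x) * ((1 + x - r) * (r - x + t * (2 - x)) / (t * (2 - x ^ 2 - (1 - x) * r) - x * (x - r))))) * (((w + t) - (r + d + 2 * t)) * ((1 - x) * (r + d) + x ^ 2 * w) / ((r + d + 2 * t) * (w - ((1 - x) * (r + d) + x ^ 2 * w)))) := by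
        apply mul_le_mul_of_nonneg_right _ hκ0
        nlinarith [mul_le_mul_of_nonneg_left h21w hcM1]
      linarith
    · -- heavy `p+l′ → m+l′`
      rw [h22_H hH hav, hκ_H hm hH hav, h21_H (le_trans hxwt hH) h21b]
      have := ineq_BM2_HH x r t d w hx0 hx1 hr0 hrx ht hw0 hw1 hd0 hdx hre hre1 hA2 hM1 hH hav (le_trans hxwt hH) h21b hP hm
      linarith
  · -- `m+l′` unavailable to the low `p+l`
    rw [hκ_N hmn]
    have h11n : w ≤ (r + d + 2 * t) := by linarith
    rcases lt_or_ge ((r + d + 2 * t)) (1 + t) with hP | hPn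
    · rw [h1P_H hP]
      have := ineq_E1_HNN x r t d w hx0 hx1 hr0 hrx ht hw0 hw1 hd0 hdx hre hre1 hA2 hM1 hP hmn h11n
      nlinarith [this]
    · rw [h1P_N hPn]
      have := ineq_E1_NNN x r t d w hx0 hx1 hr0 hrx ht hw0 hw1 hd0 hdx hre hre1 hA2 hM1 hPn hmn h11n
      nlinarith [this]

set_option maxHeartbeats 4000000 in
/-- **`hkA` (low 2 stops at the mid `m+l`)**: `P₁ ≤ (a₂(m+l) − P₂)·κ_A + a₁(m+l′) + a₁(p+h) + pool`. [this work] -/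
theorem hkA_holds (x r t d w e21 e1P e12 κA : ℝ) (hx0 : 0 < x) (hx1 : x < 1) (hr0 : 0 ≤ r) (hrx : r < x) (ht : 0 < t) (hw0 : 0 < w) (hw1 : w ≤ 1)
    (hd0 : 0 ≤ d) (hdx : d < x * w) (hre : 0 < r - x + t * (2 - x)) (hre1 : 0 < 1 - t - r)
    (hA2 : r + d ≤ 2) (hM1 : r + d + 2 * t ≤ 2 * w)
    (_h21_N : w - t ≤ (r + d) → e21 = 0)
    (h21_H : x * (w - t) ≤ (r + d) → (r + d) < w - t → e21 = ((w - t) / (r + d) - 1))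
    (h21_L : (r + d) < x * (w - t) → e21 = ((w - t) / ((1 - x) * (r + d) + x ^ 2 * (w - t)) - 1))
    (h1P_N : 1 + t ≤ (r + d + 2 * t) → e1P = 0)
    (h1P_H : (r + d + 2 * t) < 1 + t → e1P = ((1 + t) / (r + d + 2 * t) - 1))
    (h12_N : w + t ≤ (r + d + 2 * t) → e12 = 0)
    (h12_H : (r + d + 2 * t) < w + t → e12 = ((w + t) / (r + d + 2 * t) - 1))
    (hκ_N : w ≤ (r + d + 2 * t) → κA = 0) (hκ_H : (r + d + 2 * t) < w → x * (w - t) ≤ (r + d) → (r + d) < w - t → κA = ((w - (r + d + 2 * t)) * (r + d) / ((r + d + 2 * t) * ((w - t) - (r + d))))) (hκ_L : (r + d + 2 * t) < w → (r + d) < x * (w - t) → κA = ((w - (r + d + 2 * t)) * ((1 - x) * (r + d) + x ^ 2 * (w - t)) / ((r + d + 2 * t) * ((w - t) - ((1 - x) * (r + d) + x ^ 2 * (w - t))))))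
    (hav : (r + d) < w - t) :
    ((1 - (x ^ 2 + (1 - x) * d / w)) * (1 - x) * ((x - r) * (1 - t - r) / (t * (2 - x ^ 2 - (1 - x) * r) - x * (x - r)))) ≤ (((x ^ 2 + (1 - x) * d / w) * (1 - x) * ((x - r) * (1 - t - r) / (t * (2 - x ^ 2 - (1 - x) * r) - x * (x - r)))) * e21 - ((1 - (x ^ 2 + (1 - x) * d / w)) * (1 - x) * ((1 + x - r) * (r - x + t * (2 - x)) / (t * (2 - x ^ 2 - (1 - x) * r) - x * (x - r))))) * κA + ((x ^ 2 + (1 - x) * d / w) * (1 - x) * ((1 + x - r) * (r - x + t * (2 - x)) / (t * (2 - x ^ 2 - (1 - x) * r) - x * (x - r)))) * e12 + ((1 - (x ^ 2 + (1 - x) * d / w)) * x) * e1P + ((x ^ 2 + (1 - x) * d / w) * (1 - x)) := by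
  have hD : 0 < t * (2 - x ^ 2 - (1 - x) * r) - x * (x - r) := D_pos x r t hx0 hx1 hr0 hrx hre
  have hxw : x * w ≤ x := by nlinarith
  have hxwt : x * (w - t) ≤ x * w := by nlinarith
  have hg0 : 0 ≤ (x ^ 2 + (1 - x) * d / w) := by positivity
  have hlam : 0 ≤ (x - r) * (1 - t - r) / (t * (2 - x ^ 2 - (1 - x) * r) - x * (x - r)) := div_nonneg (mul_nonneg (by linarith) (by linarith)) hD.le
  have hlaml : 0 ≤ (1 + x - r) * (r - x + t * (2 - x)) / (t * (2 - x ^ 2 - (1 - x) * r) - x * (x - r)) := div_nonneg (mul_nonneg (by linarith) hre.le) hD.le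
  have hcM1 : 0 ≤ ((x ^ 2 + (1 - x) * d / w) * (1 - x) * ((x - r) * (1 - t - r) / (t * (2 - x ^ 2 - (1 - x) * r) - x * (x - r)))) := mul_nonneg (mul_nonneg hg0 (by linarith)) hlam
  have hcM2 : 0 ≤ ((x ^ 2 + (1 - x) * d / w) * (1 - x) * ((1 + x - r) * (r - x + t * (2 - x)) / (t * (2 - x ^ 2 - (1 - x) * r) - x * (x - r)))) := mul_nonneg (mul_nonneg hg0 (by linarith)) hlaml
  rcases lt_or_ge ((r + d + 2 * t)) w with h1 | h1n
  · -- the low `p+l` may use `m+l`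
    have hm : (r + d + 2 * t) < w + t := by linarith
    have hP : (r + d + 2 * t) < 1 + t := by linarith
    have hwt : t < w := by linarith
    rw [h1P_H hP, h12_H hm]
    rcases lt_or_ge ((r + d)) (x * (w - t)) with hL | hH
    · rw [h21_L hL, hκ_L h1 hL]
      have := ineq_BM1_Lx x r t d w hx0 hx1 hr0 hrx ht hw0 hw1 hd0 hdx hre hre1 hA2 hM1 hP hm h1 hL hwt
      linarith
    · rw [h21_H hH hav, hκ_H h1 hH hav]
      have := ineq_BM1_H x r t d w hx0 hx1 hr0 hrx ht hw0 hw1 hd0 hdx hre hre1 hA2 hM1 hH hav hP hm h1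
      linarith
  · rw [hκ_N h1n]
    rcases lt_or_ge ((r + d + 2 * t)) (w + t) with hm | hmn
    · have hP : (r + d + 2 * t) < 1 + t := by linarith
      rw [h1P_H hP, h12_H hm]
      have := ineq_E1_HHN x r t d w hx0 hx1 hr0 hrx ht hw0 hw1 hd0 hdx hre hre1 hA2 hM1 hP hm h1n
      nlinarith [this]
    · rw [h12_N hmn]
      rcases lt_or_ge ((r + d + 2 * t)) (1 + t) with hP | hPn
      · rw [h1P_H hP]
        have := ineq_E1_HNN x r t d w hx0 hx1 hr0 hrx ht hw0 hw1 hd0 hdx hre hre1 hA2 hM1 hP hmn h1n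
        nlinarith [this]
      · rw [h1P_N hPn]
        have := ineq_E1_NNN x r t d w hx0 hx1 hr0 hrx ht hw0 hw1 hd0 hdx hre hre1 hA2 hM1 hPn hmn h1n
        nlinarith [this]

end LSCoreMMG

end LawDec

end Quant

end Summit.CriticalPhenomena.PercolationContinuityZ3.Theorems
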